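import Mathlib
import HarnessLib

/-!
# Gauss rules from the continued fraction of `∫ w(x)/(z − x) dx` (Davis–Rabinowitz 1984, Sect. 2.7.4, (2.7.4.1)–(2.7.4.2))

**Source.** P. J. Davis, P. Rabinowitz, *Methods of Numerical Integration* (2nd ed., Academic Press, 1984),
Sect. 2.7.4 "Determination of Gaussian Integration Formulas through the Use of Continued Fractions"
(Rutishauser; Szegő, *Orthogonal Polynomials*, pp. 54–57).

**Statement.** Expand the transform `∫_a^b w(x)/(z − x) dx` in its continued fraction (2.7.4.1) and let `R_n(z)/S_n(z)`
be the successive convergents. Then the denominators `S_n` are the orthogonal polynomials on `[a, b]` with respect to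
`w`, so the poles of the `n`-th convergent are the Gauss abscissas `x_{kn}`, and
`R_n(z)/S_n(z) = const · Σ_k w_{kn}/(z − x_{kn})` (2.7.4.2): the residues are the Gauss weights.

**What is typed** (all PROVED, Mathlib only). The convergents of a J-fraction
`m₀ / (z − a₀ − b₁/(z − a₁ − b₂/(z − a₂ − ⋯)))` have numerators and denominators generated by the same three-term
recurrence `y_{n+1} = (z − a_n) y_n − b_n y_{n−1}` with `S_0 = 1, S_1 = z − a₀` and `R_0 = 0, R_1 = m₀`
(`jfracDen`, `jfracNum`, over any commutative ring). For the Legendre weight `w ≡ 1` on `[−1, 1]` (`m₀ = 2`, `a_n = 0`,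
`b_n = n²/(4n² − 1)`: `legendreJB`) we verify by hand, for `n = 1, 2, 3`:
* the denominators `S_1 = z`, `S_2 = z² − 1/3`, `S_3 = z³ − (3/5) z` (the monic Legendre polynomials; their
  orthogonality to lower powers on `[−1, 1]` is checked by `∫`: `integral_legendreS_two`, `integral_legendreS_two_mul_X`,
  `integral_legendreS_three_mul_X`) and numerators `R_1 = 2`, `R_2 = 2z`, `R_3 = 2z² − 8/15`;
* (2.7.4.2) with `const = 1`: `R_2/S_2 = 1/(z − c) + 1/(z + c)` (`c² = 1/3`; weights `1, 1`) and
  `R_3/S_3 = (8/9)/z + (5/9)/(z − s) + (5/9)/(z + s)` (`s² = 3/5`), i.e. the residues `R_n(x_k)/S_n'(x_k)` are the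
  Gauss–Legendre weights (`gauss_weight_residue_two/three`);
* the defining property of the convergents as Padé-type approximants of the moment series
  `L(z) = Σ_j m_j z^{−j−1}` (`m_j = ∫_{−1}^1 x^j dx`): `S_n(z) L_{2n}(z) − R_n(z) = O(z^{−n−1})`, written polynomially as
  `z^{2n} (S_n L_{2n} − R_n)` having degree `≤ n − 1` (`pade_legendre_one/two/three`, with the explicit remainders
  `0`, `−(2/9) z`, `−(6/25) z²`).
The Q-D algorithm and the general-`n` statements are not formalised.

References: [cite: DavisRabinowitz1984, Sect. 2.7.4 (2.7.4.1)-(2.7.4.2)].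
-/

namespace Literature.Analysis.Quadrature

open Polynomial intervalIntegral

section JFraction

variable {R : Type*} [CommRing R]

/-- Denominators `S_n` of the convergents of the J-fraction `m₀/(z − a₀ − b₁/(z − a₁ − b₂/(⋯)))`:
`S_0 = 1`, `S_1 = X − a₀`, `S_{n+2} = (X − a_{n+1}) S_{n+1} − b_{n+1} S_n`. [cite: DavisRabinowitz1984, Sect. 2.7.4 (2.7.4.1)] -/
noncomputable def jfracDen (a b : ℕ → R) : ℕ → R[X]
  | 0 => 1
  | 1 => X - C (a 0)
  | n + 2 => (X - C (a (n + 1))) * jfracDen a b (n + 1) - C (b (n + 1)) * jfracDen a b n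

/-- Numerators `R_n` of the same convergents: `R_0 = 0`, `R_1 = m₀`, same recurrence.
[cite: DavisRabinowitz1984, Sect. 2.7.4 (2.7.4.1)] -/
noncomputable def jfracNum (m₀ : R) (a b : ℕ → R) : ℕ → R[X]
  | 0 => 0
  | 1 => C m₀
  | n + 2 => (X - C (a (n + 1))) * jfracNum m₀ a b (n + 1) - C (b (n + 1)) * jfracNum m₀ a b n

/-- The three-term recurrence of the denominators. [cite: DavisRabinowitz1984, Sect. 2.7.4 (2.7.4.1)] -/
theorem jfracDen_add_two (a b : ℕ → R) (n : ℕ) :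
    jfracDen a b (n + 2) = (X - C (a (n + 1))) * jfracDen a b (n + 1) - C (b (n + 1)) * jfracDen a b n := rfl

/-- The three-term recurrence of the numerators. [cite: DavisRabinowitz1984, Sect. 2.7.4 (2.7.4.1)] -/
theorem jfracNum_add_two (m₀ : R) (a b : ℕ → R) (n : ℕ) :
    jfracNum m₀ a b (n + 2) =
      (X - C (a (n + 1))) * jfracNum m₀ a b (n + 1) - C (b (n + 1)) * jfracNum m₀ a b n := rfl

/-- The first convergent is `m₀/(z − a₀)`. [cite: DavisRabinowitz1984, Sect. 2.7.4 (2.7.4.1)] -/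
theorem jfrac_convergent_one (m₀ : R) (a b : ℕ → R) :
    jfracNum m₀ a b 1 = C m₀ ∧ jfracDen a b 1 = X - C (a 0) := ⟨rfl, rfl⟩

/-- The second convergent: `R_2 = m₀ (X − a₁)`, `S_2 = (X − a₁)(X − a₀) − b₁`.
[cite: DavisRabinowitz1984, Sect. 2.7.4 (2.7.4.1)] -/
theorem jfrac_convergent_two (m₀ : R) (a b : ℕ → R) :
    jfracNum m₀ a b 2 = (X - C (a 1)) * C m₀ ∧ jfracDen a b 2 = (X - C (a 1)) * (X - C (a 0)) - C (b 1) := by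
  simp [jfracNum, jfracDen]

end JFraction

/-! ## The Legendre case `w ≡ 1` on `[−1, 1]`: `m₀ = 2`, `a_n = 0`, `b_n = n²/(4n² − 1)` -/

/-- The Legendre J-fraction coefficients `b_n = n²/(4n² − 1)` (`b_1 = 1/3`, `b_2 = 4/15`, …).
[cite: DavisRabinowitz1984, Sect. 2.7.4 (2.7.4.1)] -/
noncomputable def legendreJB (n : ℕ) : ℝ := (n : ℝ) ^ 2 / (4 * (n : ℝ) ^ 2 - 1)

/-- `b_1 = 1/3`, `b_2 = 4/15`, `b_3 = 9/35`. [cite: DavisRabinowitz1984, Sect. 2.7.4 (2.7.4.1)] -/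
theorem legendreJB_values : legendreJB 1 = 1 / 3 ∧ legendreJB 2 = 4 / 15 ∧ legendreJB 3 = 9 / 35 := by
  unfold legendreJB; norm_num

/-- The Legendre denominators `S_n = jfracDen 0 legendreJB n`. [cite: DavisRabinowitz1984, Sect. 2.7.4 (2.7.4.1)] -/
noncomputable def legendreS (n : ℕ) : ℝ[X] := jfracDen (fun _ => 0) legendreJB n

/-- The Legendre numerators `R_n = jfracNum 2 0 legendreJB n`. [cite: DavisRabinowitz1984, Sect. 2.7.4 (2.7.4.1)] -/
noncomputable def legendreR (n : ℕ) : ℝ[X] := jfracNum 2 (fun _ => 0) legendreJB n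

/-- `S_1 = X`, `S_2 = X² − 1/3`, `S_3 = X³ − (3/5) X` (monic Legendre polynomials), as evaluations.
[cite: DavisRabinowitz1984, Sect. 2.7.4 (2.7.4.1)] -/
theorem legendreS_eval (z : ℝ) :
    (legendreS 1).eval z = z ∧ (legendreS 2).eval z = z ^ 2 - 1 / 3 ∧
      (legendreS 3).eval z = z ^ 3 - 3 / 5 * z := by
  simp only [legendreS, jfracDen, legendreJB, eval_sub, eval_mul, eval_X, eval_C, eval_one]
  norm_num
  constructor <;> ring

/-- `R_1 = 2`, `R_2 = 2X`, `R_3 = 2X² − 8/15`, as evaluations. [cite: DavisRabinowitz1984, Sect. 2.7.4 (2.7.4.1)] -/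
theorem legendreR_eval (z : ℝ) :
    (legendreR 1).eval z = 2 ∧ (legendreR 2).eval z = 2 * z ∧ (legendreR 3).eval z = 2 * z ^ 2 - 8 / 15 := by
  simp only [legendreR, jfracNum, legendreJB, eval_sub, eval_mul, eval_X, eval_C, eval_zero]
  norm_num
  constructor <;> ring

/-! ### The denominators are the orthogonal polynomials (checked for `n = 2, 3`) -/

/-- [folklore] continuous functions are interval integrable (local helper). -/
private theorem ii {f : ℝ → ℝ} (hf : Continuous f) (a b : ℝ) : IntervalIntegrable f MeasureTheory.volume a b :=
  hf.intervalIntegrable a b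

/-- `∫_{−1}^1 S_2(x) dx = 0`. [cite: DavisRabinowitz1984, Sect. 2.7.4 (2.7.4.1)] -/
theorem integral_legendreS_two : ∫ x in (-1:ℝ)..1, (x ^ 2 - 1 / 3) = 0 := by
  rw [integral_sub (ii (by fun_prop) _ _) (ii (by fun_prop) _ _), integral_pow, intervalIntegral.integral_const]
  norm_num

/-- `∫_{−1}^1 x S_2(x) dx = 0`. [cite: DavisRabinowitz1984, Sect. 2.7.4 (2.7.4.1)] -/
theorem integral_legendreS_two_mul_X : ∫ x in (-1:ℝ)..1, x * (x ^ 2 - 1 / 3) = 0 := by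
  have : (fun x : ℝ => x * (x ^ 2 - 1 / 3)) = fun x => x ^ 3 - 1 / 3 * x := by ext x; ring
  rw [this, integral_sub (ii (by fun_prop) _ _) (ii (by fun_prop) _ _), integral_pow, intervalIntegral.integral_const_mul, integral_id]
  norm_num

/-- `∫_{−1}^1 S_3(x) dx = 0` and `∫_{−1}^1 x² S_3(x) dx = 0` hold by oddness; the even test is `∫_{−1}^1 x S_3(x) dx = 0`.
[cite: DavisRabinowitz1984, Sect. 2.7.4 (2.7.4.1)] -/
theorem integral_legendreS_three_mul_X : ∫ x in (-1:ℝ)..1, x * (x ^ 3 - 3 / 5 * x) = 0 := by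
  have : (fun x : ℝ => x * (x ^ 3 - 3 / 5 * x)) = fun x => x ^ 4 - 3 / 5 * x ^ 2 := by ext x; ring
  rw [this, integral_sub (ii (by fun_prop) _ _) (ii (by fun_prop) _ _), integral_pow, intervalIntegral.integral_const_mul, integral_pow]
  norm_num

/-- `∫_{−1}^1 S_3(x) dx = 0`. [cite: DavisRabinowitz1984, Sect. 2.7.4 (2.7.4.1)] -/
theorem integral_legendreS_three : ∫ x in (-1:ℝ)..1, (x ^ 3 - 3 / 5 * x) = 0 := by
  rw [integral_sub (ii (by fun_prop) _ _) (ii (by fun_prop) _ _), integral_pow, intervalIntegral.integral_const_mul, integral_id]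
  norm_num

/-! ### (2.7.4.2): partial fractions of the convergents = Gauss rules (const = 1) -/

/-- `n = 1`: `R_1/S_1 = 2/z` — the midpoint rule `G_1` (weight `2` at `0`). [cite: DavisRabinowitz1984, Sect. 2.7.4 (2.7.4.2)] -/
theorem jfrac_partialFractions_one (z : ℝ) :
    (legendreR 1).eval z / (legendreS 1).eval z = 2 / (z - 0) := by
  rw [(legendreR_eval z).1, (legendreS_eval z).1, sub_zero]

/-- `n = 2`: `2z/(z² − 1/3) = 1/(z − c) + 1/(z + c)` for `c² = 1/3` — the rule `G_2` (weights `1, 1` at `±c`).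
[cite: DavisRabinowitz1984, Sect. 2.7.4 (2.7.4.2)] -/
theorem jfrac_partialFractions_two {c z : ℝ} (hc : c ^ 2 = 1 / 3) (hz : z ^ 2 ≠ 1 / 3) :
    (legendreR 2).eval z / (legendreS 2).eval z = 1 / (z - c) + 1 / (z + c) := by
  rw [(legendreR_eval z).2.1, (legendreS_eval z).2.1]
  have h1 : z - c ≠ 0 := by
    intro h; apply hz; rw [show z = c by linarith, hc]
  have h2 : z + c ≠ 0 := by
    intro h; apply hz; rw [show z = -c by linarith, neg_sq, hc]
  have h3 : z ^ 2 - c ^ 2 ≠ 0 := by rw [hc]; exact sub_ne_zero.2 hz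
  have key : 1 / (z - c) + 1 / (z + c) = 2 * z / (z ^ 2 - c ^ 2) := by
    rw [show z ^ 2 - c ^ 2 = (z - c) * (z + c) by ring] at h3 ⊢
    field_simp
    ring
  rw [key, hc]

/-- `n = 3`: `(2z² − 8/15)/(z³ − 3z/5) = (8/9)/z + (5/9)/(z − s) + (5/9)/(z + s)` for `s² = 3/5` — the rule `G_3`.
[cite: DavisRabinowitz1984, Sect. 2.7.4 (2.7.4.2)] -/
theorem jfrac_partialFractions_three {s z : ℝ} (hs : s ^ 2 = 3 / 5) (hz : z ≠ 0) (hz' : z ^ 2 ≠ 3 / 5) :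
    (legendreR 3).eval z / (legendreS 3).eval z = 8 / 9 / z + 5 / 9 / (z - s) + 5 / 9 / (z + s) := by
  rw [(legendreR_eval z).2.2, (legendreS_eval z).2.2]
  have h1 : z - s ≠ 0 := by
    intro h; apply hz'; rw [show z = s by linarith, hs]
  have h2 : z + s ≠ 0 := by
    intro h; apply hz'; rw [show z = -s by linarith, neg_sq, hs]
  have h3 : z ^ 2 - s ^ 2 ≠ 0 := by rw [hs]; exact sub_ne_zero.2 hz'
  have key : 8 / 9 / z + 5 / 9 / (z - s) + 5 / 9 / (z + s) = (2 * z ^ 2 - 8 / 9 * s ^ 2) / (z * (z ^ 2 - s ^ 2)) := by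
    rw [show z ^ 2 - s ^ 2 = (z - s) * (z + s) by ring] at h3 ⊢
    field_simp
    ring
  rw [key, hs]
  congr 1 <;> ring

/-! ### Residues `R_n(x_k)/S_n'(x_k)` are the Gauss weights -/

/-- `n = 2`: `R_2(c)/S_2'(c) = 2c/(2c) = 1`. [cite: DavisRabinowitz1984, Sect. 2.7.4 (2.7.4.2)] -/
theorem gauss_weight_residue_two {c : ℝ} (hc : c ^ 2 = 1 / 3) :
    (legendreR 2).eval c / (derivative (legendreS 2)).eval c = 1 := by
  have hc0 : c ≠ 0 := by intro h; rw [h] at hc; norm_num at hc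
  have hS : legendreS 2 = X ^ 2 - C (1 / 3 : ℝ) :=
    Polynomial.funext fun x => by rw [(legendreS_eval x).2.1]; simp
  have hd : (derivative (legendreS 2)).eval c = 2 * c := by
    rw [hS]; simp; norm_num
  rw [(legendreR_eval c).2.1, hd]
  exact div_self (mul_ne_zero two_ne_zero hc0)

/-- `n = 3`: `R_3(0)/S_3'(0) = (−8/15)/(−3/5) = 8/9` and `R_3(s)/S_3'(s) = (2s² − 8/15)/(3s² − 3/5) = 5/9`.
[cite: DavisRabinowitz1984, Sect. 2.7.4 (2.7.4.2)] -/
theorem gauss_weight_residue_three {s : ℝ} (hs : s ^ 2 = 3 / 5) :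
    (legendreR 3).eval 0 / (derivative (legendreS 3)).eval 0 = 8 / 9 ∧
      (legendreR 3).eval s / (derivative (legendreS 3)).eval s = 5 / 9 := by
  have hS : legendreS 3 = X ^ 3 - C (3 / 5 : ℝ) * X :=
    Polynomial.funext fun x => by rw [(legendreS_eval x).2.2]; simp
  have hd : ∀ x : ℝ, (derivative (legendreS 3)).eval x = 3 * x ^ 2 - 3 / 5 := by
    intro x; rw [hS]; simp; norm_num
  rw [(legendreR_eval 0).2.2, (legendreR_eval s).2.2, hd, hd, hs]
  norm_num

/-! ### Padé property: `S_n L_{2n} − R_n = O(z^{−n−1})` for the moment series `L(z) = 2/z + (2/3)/z³ + (2/5)/z⁵ + ⋯` -/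

/-- `n = 1`: `z² (S_1 · (2/z) − R_1) = 0`. [cite: DavisRabinowitz1984, Sect. 2.7.4 (2.7.4.1)] -/
theorem pade_legendre_one (z : ℝ) : (legendreS 1).eval z * (2 * z) - (legendreR 1).eval z * z ^ 2 = 0 := by
  rw [(legendreS_eval z).1, (legendreR_eval z).1]; ring

/-- `n = 2`: `z⁴ (S_2 L_4 − R_2) = S_2(z)(2z³ + (2/3) z) − R_2(z) z⁴ = −(2/9) z` (degree `1 ≤ n − 1`): the convergent
matches the moments `m_0, …, m_3 = 2, 0, 2/3, 0`. [cite: DavisRabinowitz1984, Sect. 2.7.4 (2.7.4.1)] -/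
theorem pade_legendre_two (z : ℝ) :
    (legendreS 2).eval z * (2 * z ^ 3 + 2 / 3 * z) - (legendreR 2).eval z * z ^ 4 = -(2 / 9) * z := by
  rw [(legendreS_eval z).2.1, (legendreR_eval z).2.1]; ring

/-- `n = 3`: `z⁶ (S_3 L_6 − R_3) = S_3(z)(2z⁵ + (2/3) z³ + (2/5) z) − R_3(z) z⁶ = −(6/25) z²` (degree `2 ≤ n − 1`): the
convergent matches `m_0, …, m_5 = 2, 0, 2/3, 0, 2/5, 0`. [cite: DavisRabinowitz1984, Sect. 2.7.4 (2.7.4.1)] -/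
theorem pade_legendre_three (z : ℝ) :
    (legendreS 3).eval z * (2 * z ^ 5 + 2 / 3 * z ^ 3 + 2 / 5 * z) - (legendreR 3).eval z * z ^ 6 =
      -(6 / 25) * z ^ 2 := by
  rw [(legendreS_eval z).2.2, (legendreR_eval z).2.2]; ring

/-- The moments used above are those of `w ≡ 1` on `[−1, 1]`: `m_j = ∫_{−1}^1 x^j dx = (1 + (−1)^j)/(j + 1)`, i.e.
`2, 0, 2/3, 0, 2/5, 0` for `j = 0, …, 5`. [cite: DavisRabinowitz1984, Sect. 2.7.4 (2.7.4.1)] -/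
theorem legendre_moments :
    (∫ x in (-1:ℝ)..1, x ^ 0) = 2 ∧ (∫ x in (-1:ℝ)..1, x ^ 1) = 0 ∧ (∫ x in (-1:ℝ)..1, x ^ 2) = 2 / 3 ∧
      (∫ x in (-1:ℝ)..1, x ^ 3) = 0 ∧ (∫ x in (-1:ℝ)..1, x ^ 4) = 2 / 5 ∧ (∫ x in (-1:ℝ)..1, x ^ 5) = 0 := by
  refine ⟨?_, ?_, ?_, ?_, ?_, ?_⟩ <;> rw [integral_pow] <;> norm_num

end Literature.Analysis.Quadrature
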